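import Summits.ResolutionOfSingularities.ResolutionOfSingularities.Theorems.FrobeniusClosingSteerLogFrame
import Summits.ResolutionOfSingularities.ResolutionOfSingularities.Theorems.FrobeniusClosingSteerLogFrameReading
import HarnessLib

/-!
# Crux `Steer` (stmt-ResolutionOfSingularities-16345), chain W4.1 — idea-2's dictionary DICT
# `SimpleIsLogFinal`, piece **4: the NORMAL FORM of a first integral at a simple point** — assembling the
# log frame (piece 1), the `α_p`-projection and `μ_p`-weights (piece 2) and the exchange + Kunz reading (piece 3)

OURS (campaign `res-hironaka`, rung L, slot W4.1, chain W4.1; seat res-D-pv-007 AS res-L0-w41-stub-5; replaces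
the role of no printed item; NOT a statement of the manuscript under review [claim: Hironaka2017, status:
under-review]; AI-produced, weaker than expert review). Theses-free, definition-free, pure commutative algebra.

## Statement (`LogFrame.exists_normalForm`)

`S` a regular local ring of prime characteristic `p`, F-finite with perfect residue field (Kunz `p`-basis
available), `X : Fin n → S` a regular system of parameters with dual derivations `Δ` determining `Der_ℤ(S)`,
`J` a set of BOUNDARY indices, and `f ∈ S` with a SIMPLE (log-elementary) point of `d f` along `(X j)_{j ∈ J}`:
`q ≠ 0` divides `θ f` for every logarithmic `θ` and some logarithmic `θ₀` attains `θ₀ f = q · unit`. THEN there are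
a regular system of parameters `Y` (equal to `X` off ONE index `m₀`), exponents `ν` with `ν m₀ = 1`, `D ≠ 0` and
`e` with
`D ^ p * f = ∑_{k<p} (e k) ^ p * w₀ ^ k`, `w₀ := ∏ i, Y i ^ ν i`
— `f` is a `p`-th-power combination of the powers of ONE MONOMIAL `w₀` whose exponent at `Y m₀` is `1`.

## Proof (the pieces)

(F) piece 1 `exists_logFrame`: coefficients `c` (`c m₀ = 1`; `m₀ ∈ J` or all boundary coefficients in `𝔪`) and
the commuting frame `ε m = w m • Δ m - (c m * w m₀) • Δ m₀` of `{θ ∈ Der(log X_J) | θ f = 0}`, `ε^[p] = 0`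
off `J`, `ε^[p] = ε` and `𝔪`-preserving on `J ∖ {m₀}`. (U) piece 2 `exists_proj_of_commuting_slices` along
`U = Jᶜ ∖ {m₀}`: `X m₀ ≡ a₀` mod `(X i : i ∈ U)` with `a₀` killed by the `ε i`, `i ∈ U`. (T) piece 3
`exists_simultaneous_eigen_decomposition` over `T = J ∖ {m₀}` inside `P = 𝔪 ∩ ⋂_{i∈U} ker ε i`: `a₀ = ∑ u l`,
simultaneous eigenvectors. (Y) piece 3 `exists_span_update_eq`: some `v = u l` replaces `X m₀`: `Y = X[m₀ ↦ v]`
is a regular system of parameters. (N)+(R) in `Y` the family `X i • ε i` (`i ∈ U`), `ε j` (`j ∈ T`) is DIAGONAL with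
natural weights (`Y_i∂_{Y_i}`, `X_j∂_{X_j} + χ_j v∂_v`) and kills `f`; the only exponent vectors with all weights
`≡ 0 (mod p)` are `α ≡ α m₀ · ν` with `ν m₀ = 1`, `ν|_U = 0`, `ν j ≡ -χ_j`; piece 3 `exists_pow_mul_eq_sum_of_diag`.

[cite: Kunz1969, Thm. 2.1] [cite: Matsumura1987, §25, §30] [folklore]
-/

noncomputable section

-- `Summit.<S>.<S>.…` duplicates the summit name by design (single-problem summit).
set_option linter.dupNamespace false
set_option autoImplicit false

namespace Summit.ResolutionOfSingularities.ResolutionOfSingularities.Theorems.SwitchingDichotomy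

namespace LogFrame

open IsLocalRing Finset
open Literature.AlgebraicGeometry.Resolution

variable {S : Type*} [CommRing S]

/-- The weight sum of an indicator weight: `∑ l, α l * [l = i] = α i`. [folklore] -/
theorem sum_mul_ite_eq {n : ℕ} (α : Fin n → ℕ) (i : Fin n) (r : ℕ) :
    ∑ l, α l * (if l = i then r else 0) = α i * r := by
  rw [Finset.sum_eq_single i (fun l _ hl => by rw [if_neg hl, mul_zero])
    (fun h => absurd (Finset.mem_univ i) h), if_pos rfl]

/-- Residues: `p ∣ a + b * χ` and `a < p` give `a = (b * ((p - χ % p) % p)) % p`. [folklore] -/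
theorem eq_mod_of_dvd_add_mul {p : ℕ} [Fact p.Prime] {a b χ : ℕ} (ha : a < p) (h : p ∣ a + b * χ) :
    a = (b * ((p - χ % p) % p)) % p := by
  have hp : p.Prime := Fact.out
  have h1 : ((a : ℕ) : ZMod p) = ((b * ((p - χ % p) % p) : ℕ) : ZMod p) := by
    have h2 : ((a + b * χ : ℕ) : ZMod p) = 0 := (ZMod.natCast_eq_zero_iff _ _).mpr h
    have h3 : (((p - χ % p) % p : ℕ) : ZMod p) = -(χ : ZMod p) := by
      rw [ZMod.natCast_mod, Nat.cast_sub (Nat.mod_lt χ hp.pos).le, ZMod.natCast_self, zero_sub,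
        ZMod.natCast_mod]
    push_cast at h2 ⊢
    rw [h3, mul_neg]
    linear_combination h2
  rw [ZMod.natCast_eq_natCast_iff'] at h1
  rwa [Nat.mod_eq_of_lt ha] at h1

/-- **Normal form of a first integral at a simple point.** See the module docstring.
[cite: Kunz1969, Thm. 2.1] [cite: Matsumura1987, §25, §30] [folklore] -/
theorem exists_normalForm [IsRegularLocalRing S] [PerfectField (ResidueField S)] (p : ℕ) [Fact p.Prime]
    [CharP S p] (hF : IsFFinite p 1 S) {n : ℕ} (X : Fin n → S)
    (hX : Ideal.span (Set.range X) = maximalIdeal S) (hn : (maximalIdeal S).spanFinrank = n)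
    (Δ : Fin n → Derivation ℤ S S) (hdual : ∀ i j, Δ i (X j) = if i = j then 1 else 0)
    (hdet : ∀ δ : Derivation ℤ S S, (∀ i, δ (X i) = 0) → δ = 0) (J : Finset (Fin n)) {f q : S}
    (hq : q ≠ 0) (hdiv : ∀ θ : Derivation ℤ S S, (∀ j ∈ J, X j ∣ θ (X j)) → q ∣ θ f)
    (θ₀ : Derivation ℤ S S) (hθ₀ : ∀ j ∈ J, X j ∣ θ₀ (X j)) {u : S} (hu : IsUnit u)
    (hθ₀f : θ₀ f = q * u) :
    ∃ (Y : Fin n → S) (ν : Fin n → ℕ) (m₀ : Fin n) (D : S) (e : Fin p → S),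
      Ideal.span (Set.range Y) = maximalIdeal S ∧ ν m₀ = 1 ∧ D ≠ 0 ∧
      D ^ p * f = ∑ k : Fin p, (e k) ^ p * (∏ i, Y i ^ ν i) ^ (k : ℕ) := by
  classical
  have hp : p.Prime := Fact.out
  haveI := isDomain_of_isRegularLocalRing (R := S)
  have hz : IsRsopPart X := by simpa using isRsopPart_comp_of_rsop hn X hX id Function.injective_id
  -- ### (F) the log frame
  set w : Fin n → S := fun m => if m ∈ J then X m else 1 with hw
  obtain ⟨m₀, c, q', hq', hm₀, hc, -, hεf, hεy, hεcomm, hεnil, hεself, hεmax, -⟩ :=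
    exists_logFrame p X hX Δ hdual hdet J w (fun m => rfl) hq hdiv θ₀ hθ₀ hu hθ₀f
  set ε : Fin n → Derivation ℤ S S := fun m => w m • Δ m - (c m * w m₀) • Δ m₀ with hε
  -- the unipotent indices `U` and the torus indices `T`
  set U : Finset (Fin n) := (Finset.univ \ J).erase m₀ with hU
  set T : Finset (Fin n) := J.erase m₀ with hT
  have hUmem : ∀ {i}, i ∈ U → i ∉ J ∧ i ≠ m₀ := fun {i} hi => by
    rw [hU, Finset.mem_erase, Finset.mem_sdiff] at hi
    exact ⟨hi.2.2, hi.1⟩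
  have hTmem : ∀ {j}, j ∈ T → j ∈ J ∧ j ≠ m₀ := fun {j} hj => by
    rw [hT, Finset.mem_erase] at hj
    exact ⟨hj.2, hj.1⟩
  have hwU : ∀ {i}, i ∈ U → w i = 1 := fun {i} hi => by rw [hw]; exact if_neg (hUmem hi).1
  have hwT : ∀ {j}, j ∈ T → w j = X j := fun {j} hj => by rw [hw]; exact if_pos (hTmem hj).1
  -- ### (U) projection of `X m₀` along the unipotent part
  obtain ⟨a₀, ha₀U, ha₀mem, -⟩ := exists_proj_of_commuting_slices p (fun i : U => ε i) (fun i : U => X i)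
    (fun i i' => by
      rw [hε]
      dsimp only
      rw [hεy i i' (hUmem i'.2).2, hwU i.2]
      simp only [Subtype.ext_iff])
    (fun i i' a => hεcomm i i' a) (fun i a => hεnil i (hUmem i.2).1 a) Finset.univ (X m₀)
  have hspanU : Ideal.span ((fun i : U => X (i : Fin n)) '' (Finset.univ : Finset U)) ≤
      Ideal.span (X '' {m | m ≠ m₀}) := by
    refine Ideal.span_mono ?_
    rintro _ ⟨i, -, rfl⟩
    exact ⟨i, (hUmem i.2).2, rfl⟩
  have ha₀max : a₀ ∈ maximalIdeal S := by
    have h1 : a₀ = X m₀ - (X m₀ - a₀) := by ring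
    rw [h1]
    refine Ideal.sub_mem _ (hX ▸ Ideal.subset_span ⟨m₀, rfl⟩) ?_
    have hle : Ideal.span (X '' {m | m ≠ m₀}) ≤ maximalIdeal S := by
      rw [← hX]; exact Ideal.span_mono (Set.image_subset_range _ _)
    exact hle (hspanU ha₀mem)
  -- ### (T) simultaneous weights inside `P = 𝔪 ∩ ⋂_{i ∈ U} ker (ε i)`
  let P : AddSubgroup S :=
    { carrier := {b | b ∈ maximalIdeal S ∧ ∀ i : U, ε i b = 0}
      add_mem' := fun {a b} ha hb => ⟨Ideal.add_mem _ ha.1 hb.1, fun i => by rw [map_add, ha.2 i, hb.2 i, add_zero]⟩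
      zero_mem' := ⟨Ideal.zero_mem _, fun i => map_zero _⟩
      neg_mem' := fun {a} ha => ⟨(maximalIdeal S).neg_mem ha.1, fun i => by rw [map_neg, ha.2 i, neg_zero]⟩ }
  have hPmem : ∀ b, b ∈ P ↔ b ∈ maximalIdeal S ∧ ∀ i : U, ε i b = 0 := fun b => Iff.rfl
  obtain ⟨N, us, χ, husum, husP, husχ⟩ := exists_simultaneous_eigen_decomposition p (fun j : T => ε j)
    (fun j a => hεself j (hTmem j.2).1 (hTmem j.2).2 a) (fun j j' a => hεcomm j j' a) P
    (fun j b hb => (hPmem _).mpr ⟨hεmax j (hTmem j.2).1 (hTmem j.2).2 b hb.1,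
      fun i => by
        show ε i (ε j b) = 0
        rw [hεcomm, ((hPmem b).mp hb).2 i, map_zero]⟩)
    Finset.univ ((hPmem a₀).mpr ⟨ha₀max, fun i => ha₀U i (Finset.mem_univ _)⟩)
  -- ### (Y) exchange `X m₀ ↦ v := us l`
  obtain ⟨l₀, hY⟩ := exists_span_update_eq X hz hX m₀ us (fun l => ((hPmem _).mp (husP l)).1)
    (by rw [husum]; exact hspanU ha₀mem)
  set v : S := us l₀ with hv
  set Y : Fin n → S := Function.update X m₀ v with hYdef
  have hYm₀ : Y m₀ = v := by rw [hYdef, Function.update_self]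
  have hYne : ∀ {l}, l ≠ m₀ → Y l = X l := fun {l} hl => by rw [hYdef, Function.update_of_ne hl]
  have hvU : ∀ i : U, ε i v = 0 := ((hPmem v).mp (husP l₀)).2
  have hvT : ∀ j : T, ε j v = (χ l₀ j : S) * v := fun j => husχ l₀ j (Finset.mem_univ _)
  -- ### (N) the diagonal family in the coordinates `Y`
  let θ : U ⊕ T → Derivation ℤ S S := fun k => Sum.elim (fun i : U => X i • ε i) (fun j : T => ε j) k
  let wt : U ⊕ T → Fin n → ℕ := fun k l => Sum.elim (fun i : U => if l = i then 1 else 0)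
    (fun j : T => (if l = j then 1 else 0) + (if l = m₀ then χ l₀ j else 0)) k
  have hθ : ∀ k l, θ k (Y l) = (wt k l : S) * Y l := by
    rintro (i | j) l
    · show (X (i : Fin n) • ε i) (Y l) = ((if l = i then 1 else 0 : ℕ) : S) * Y l
      rw [Derivation.smul_apply, smul_eq_mul]
      by_cases hl : l = m₀
      · subst hl
        rw [hYm₀, hvU i, mul_zero, if_neg (Ne.symm (hUmem i.2).2), Nat.cast_zero, zero_mul]
      · rw [hYne hl, hε]
        dsimp only
        rw [hεy i l hl, hwU i.2]
        by_cases hil : (i : Fin n) = l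
        · rw [if_pos hil, if_pos hil.symm, hil, Nat.cast_one, mul_one, one_mul]
        · rw [if_neg hil, if_neg (Ne.symm hil), mul_zero, Nat.cast_zero, zero_mul]
    · show ε j (Y l) = (((if l = j then 1 else 0) + (if l = m₀ then χ l₀ j else 0) : ℕ) : S) * Y l
      by_cases hl : l = m₀
      · subst hl
        rw [hYm₀, hvT j, if_neg (Ne.symm (hTmem j.2).2), if_pos rfl, zero_add]
      · rw [hYne hl, hε]
        dsimp only
        rw [hεy j l hl, hwT j.2, if_neg hl, add_zero]
        by_cases hjl : (j : Fin n) = l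
        · rw [if_pos hjl, if_pos hjl.symm, hjl, Nat.cast_one, one_mul]
        · rw [if_neg hjl, if_neg (Ne.symm hjl), Nat.cast_zero, zero_mul]
  have hθf : ∀ k, θ k f = 0 := by
    rintro (i | j)
    · show (X (i : Fin n) • ε i) f = 0
      rw [Derivation.smul_apply, hε]
      dsimp only
      rw [hεf, smul_zero]
    · show ε j f = 0
      rw [hε]
      exact hεf j
  -- ### (R) the exponent vector `ν` and the Kunz reading
  let ν : Fin n → ℕ := fun l =>
    if l = m₀ then 1 else if hl : l ∈ T then (p - χ l₀ ⟨l, hl⟩ % p) % p else 0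
  have hνm₀ : ν m₀ = 1 := by simp [ν]
  have hsolve : ∀ α : Fin n → ℕ, (∀ i, α i < p) → (∀ k, p ∣ ∑ i, α i * wt k i) →
      ∀ i, α i = (α m₀ * ν i) % p := by
    intro α hα hdvd l
    by_cases hl : l = m₀
    · subst hl
      rw [hνm₀, mul_one, Nat.mod_eq_of_lt (hα _)]
    by_cases hlJ : l ∈ J
    · have hlT : l ∈ T := by rw [hT, Finset.mem_erase]; exact ⟨hl, hlJ⟩
      have h := hdvd (Sum.inr ⟨l, hlT⟩)
      simp only [wt, Sum.elim_inr, mul_add, Finset.sum_add_distrib, sum_mul_ite_eq, mul_one] at h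
      have hν : ν l = (p - χ l₀ ⟨l, hlT⟩ % p) % p := by simp [ν, hl, hlT]
      rw [hν]
      exact eq_mod_of_dvd_add_mul (hα l) h
    · have hlU : l ∈ U := by
        rw [hU, Finset.mem_erase, Finset.mem_sdiff]
        exact ⟨hl, Finset.mem_univ _, hlJ⟩
      have h := hdvd (Sum.inl ⟨l, hlU⟩)
      simp only [wt, Sum.elim_inl, sum_mul_ite_eq, mul_one] at h
      have hlT : l ∉ T := fun h' => hlJ (hTmem h').1
      have hν : ν l = 0 := by simp [ν, hl, hlT]
      rw [hν, mul_zero, Nat.zero_mod]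
      exact Nat.eq_zero_of_dvd_of_lt h (hα l)
  obtain ⟨D, e, hD, hrel⟩ := exists_pow_mul_eq_sum_of_diag p hF Y hY hn θ wt hθ hθf m₀ ν hνm₀ hsolve
  exact ⟨Y, ν, m₀, D, e, hY, hνm₀, hD, hrel⟩

end LogFrame

end Summit.ResolutionOfSingularities.ResolutionOfSingularities.Theorems.SwitchingDichotomy
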